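import Summits.SmoothPoincare4.SmoothPoincare4.Theorems.CongruenceShadowsAgkCor6SufficiencyGeomMarkingDefs
import Literature.Topology.PlaneTopology.AnnulusTheorem
import Literature.Topology.PlaneTopology.CellSchoenflies
import Literature.Topology.Euclidean.InvarianceOfDomain
import Literature.AlgebraicTopology.Homotopy.StrongDeformationRetractTransport
import Literature.AlgebraicTopology.FundamentalGroup.DeformationRetractInclusion

/-!
# Stub `stub_nestedCellsRegion` of line `lp-by-sphere-system-surgery` for crux `AgkCor6Sufficiency`
(item stmt-SmoothPoincare4-10894; lead reshape r6b) — the 2D annulus theorem step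

For two chart-like `2`-cells `Φ`, `Ψ` in `F ⊆ X` (`X` Hausdorff) with `Φ(B̄(0,1)) ⊆ Ψ(B(0,1))`,
the region `R = Ψ(B̄(0,1)) ∖ Φ(B(0,1))` is a closed annulus: it strong deformation retracts onto
the outer circle `Ψ(‖z‖ = 1)`, it is path connected, and the inclusion of the inner circle
`Φ(‖z‖ = 1)` maps generators of `π₁` to generators.

Proof.  Read everything in the coordinates of `Ψ` (an embedding of the closed disc, `X` being
Hausdorff), on `ℂ ≅ ℝ²` (`Complex.orthonormalBasisOneI`): the transition map
`f = Ψ⁻¹ ∘ Φ` is continuous and injective on the closed unit disc with values in the open unit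
disc, so `f(B(0,1))` is a Jordan domain `D₁` (invariance of domain,
`Literature.Probability.RandomPlanarGeometry.JordanDomain.image`) with `closure D₁ ⊆ B(0,1)`.
The tree's annulus theorem (`Literature.Topology.PlaneTopology.exists_homeomorph_image_annulus`,
Moise (1977) Ch. 4 / Schoenflies) gives a homeomorphism `H` of `ℂ` with
`H({1 ≤ ‖z‖ ≤ 2}) = B̄(0,1) ∖ D₁`, `H(‖z‖ = 2) = (‖z‖ = 1)`, `H(‖z‖ = 1) = ∂D₁ = f(‖z‖ = 1)`; the
radial deformations of the round annulus onto its two boundary circles are transported along `H`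
and then along `Ψ` (`IsStrongDeformationRetractOf.image_of_isEmbedding`), and a strong
deformation retraction induces an isomorphism on `π₁` (Hatcher, Prop. 1.17,
`bijective_inclHomOfSubset_of_isStrongDeformationRetractOf`).  No `sorry`.
-/

set_option linter.dupNamespace false

noncomputable section

open Set Function ContinuousMap Metric
open scoped Manifold ContDiff Topology unitInterval

namespace Summit.SmoothPoincare4.SmoothPoincare4.Cruxes.AgkCor6Sufficiency.LpBySphereSystemSurgery

open Literature.Topology.FourManifolds
open Literature.AlgebraicTopology.FundamentalGroup
open Literature.AlgebraicTopology.FundamentalGroup.VanKampen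
open Literature.AlgebraicTopology.Homotopy
open Literature.Probability.RandomPlanarGeometry (JordanDomain continuousOn_invFunOn_of_isCompact)
open Literature.Probability.RandomPlanarGeometry.JordanDomain
open Literature.Topology.PlaneTopology (exists_homeomorph_image_annulus)

/-! ### Planar lemmas -/

/-- In `ℂ`, the circle `‖z‖ = c` is a strong deformation retract of the closed round annulus
`a ≤ ‖z‖ ≤ b` whenever `0 < a ≤ c ≤ b`: the radial deformation
`(t, z) ↦ ((1 - t) + t c / ‖z‖) z` (Hatcher, *Algebraic Topology*, Ch. 0 p. 2). -/
private theorem sdr_sphere_annulus {a b c : ℝ} (ha : 0 < a) (hac : a ≤ c) (hcb : c ≤ b) :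
    IsStrongDeformationRetractOf (sphere (0 : ℂ) c) {z : ℂ | a ≤ ‖z‖ ∧ ‖z‖ ≤ b} := by
  -- adapted from `Literature.Topology.FourManifolds.isStrongDeformationRetractOf_sphere_halfOpenAnnulus`
  set H : ℝ → ℂ → ℂ := fun t z => ((1 - t) + t * (c / ‖z‖)) • z with hH
  have hnorm : ∀ {t : ℝ} {z : ℂ}, t ∈ Icc (0 : ℝ) 1 → a ≤ ‖z‖ →
      ‖H t z‖ = (1 - t) * ‖z‖ + t * c := by
    intro t z ht hz
    have hz0 : 0 < ‖z‖ := ha.trans_le hz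
    have hcoef : 0 ≤ (1 - t) + t * (c / ‖z‖) :=
      add_nonneg (by linarith [ht.2]) (mul_nonneg ht.1 (div_nonneg (ha.le.trans hac) hz0.le))
    simp only [hH, norm_smul, Real.norm_of_nonneg hcoef]
    rw [add_mul, mul_assoc, div_mul_cancel₀ c hz0.ne']
  refine IsStrongDeformationRetractOf.of_continuousOn H ?_ ?_ ?_ ?_ ?_
  · have hcoef : ContinuousOn (fun p : ℝ × ℂ => (1 - p.1) + p.1 * (c / ‖p.2‖))
        (Icc (0 : ℝ) 1 ×ˢ {z : ℂ | a ≤ ‖z‖ ∧ ‖z‖ ≤ b}) := by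
      refine (continuousOn_const.sub continuousOn_fst).add (continuousOn_fst.mul
        (continuousOn_const.div continuousOn_snd.norm fun p hp => ?_))
      exact (ha.trans_le hp.2.1).ne'
    exact hcoef.smul continuousOn_snd
  · intro t ht z hz
    have hn := hnorm ht hz.1
    refine ⟨?_, ?_⟩
    · rw [hn]
      nlinarith [mul_nonneg (sub_nonneg.2 ht.2) (sub_nonneg.2 hz.1),
        mul_nonneg ht.1 (sub_nonneg.2 hac)]
    · rw [hn]
      nlinarith [mul_nonneg (sub_nonneg.2 ht.2) (sub_nonneg.2 hz.2),
        mul_nonneg ht.1 (sub_nonneg.2 hcb)]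
  · intro z _
    simp [hH]
  · intro z hz
    have hn := hnorm ⟨zero_le_one, le_rfl⟩ hz.1
    rw [mem_sphere_zero_iff_norm, hn]
    ring
  · intro t _ z _ hzc
    rw [mem_sphere_zero_iff_norm] at hzc
    have h1 : (1 - t) + t * (c / ‖z‖) = 1 := by
      rw [hzc, div_self (ha.trans_le hac).ne']
      ring
    simp only [hH, h1, one_smul]

/-- If `A ⊆ S` is a strong deformation retract of `S` and `A` is path connected, then so is `S`
(every point of `S` is joined to `A` by its track under the deformation). -/
private theorem isPathConnected_of_sdr {Y : Type*} [TopologicalSpace Y] {A S : Set Y}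
    (h : IsStrongDeformationRetractOf A S) (hAS : A ⊆ S) (hA : IsPathConnected A) :
    IsPathConnected S := by
  obtain ⟨H, h0, h1, -⟩ := h
  obtain ⟨a, haA, hjoin⟩ := hA
  refine ⟨a, hAS haA, fun y hy => ?_⟩
  let γ : Path y (H (1, ⟨y, hy⟩) : Y) :=
    { toFun := fun t => (H (t, ⟨y, hy⟩) : Y)
      continuous_toFun :=
        continuous_subtype_val.comp (H.continuous.comp (continuous_id.prodMk continuous_const))
      source' := by
        show (H (0, ⟨y, hy⟩) : Y) = y
        rw [h0]
      target' := rfl }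
  have j1 : JoinedIn S y (H (1, ⟨y, hy⟩) : Y) := ⟨γ, fun t => (H (t, ⟨y, hy⟩)).2⟩
  have j2 : JoinedIn S (H (1, ⟨y, hy⟩) : Y) a := ((hjoin (h1 ⟨y, hy⟩)).symm).mono hAS
  exact (j1.trans j2).symm

/-- Transport of a strong deformation retraction between subsets of a compact set `K ⊆ ℂ` along
a map `T : ℂ → X` continuous and injective on `K` (an embedding of `K`, `X` Hausdorff). -/
private theorem sdr_image {X : Type*} [TopologicalSpace X] [T2Space X] {T : ℂ → X}
    {K A S : Set ℂ} (hK : IsCompact K) (hTc : ContinuousOn T K) (hTi : InjOn T K)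
    (hAK : A ⊆ K) (hSK : S ⊆ K) (h : IsStrongDeformationRetractOf A S) :
    IsStrongDeformationRetractOf (T '' A) (T '' S) := by
  haveI : CompactSpace K := isCompact_iff_compactSpace.mp hK
  have hemb : Topology.IsEmbedding (K.restrict T) :=
    ((continuousOn_iff_continuous_restrict.1 hTc).isClosedEmbedding hTi.injective).isEmbedding
  have h' := (h.preimage_val hSK).image_of_isEmbedding hemb
  have hA : K.restrict T '' (Subtype.val ⁻¹' A) = T '' A := by
    rw [Set.restrict_eq, image_comp, Subtype.image_preimage_coe, inter_eq_right.2 hAK]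
  have hS : K.restrict T '' (Subtype.val ⁻¹' S) = T '' S := by
    rw [Set.restrict_eq, image_comp, Subtype.image_preimage_coe, inter_eq_right.2 hSK]
  rwa [hA, hS] at h'

/-- **The planar step (annulus theorem).** For `f` continuous and injective on the closed unit
disc of `ℂ` with values in the open unit disc, the region `B̄(0,1) ∖ f(B(0,1))` strong
deformation retracts onto the unit circle and onto the Jordan curve `f(‖z‖ = 1)`
(Moise (1977), Ch. 4: the region between two nested Jordan curves is a closed annulus). -/
private theorem planar {f : ℂ → ℂ} (hc : ContinuousOn f (closedBall 0 1))
    (hi : InjOn f (closedBall 0 1)) (hsub : MapsTo f (closedBall 0 1) (ball 0 1)) :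
    IsStrongDeformationRetractOf (sphere 0 1) (closedBall 0 1 \ f '' ball 0 1) ∧
      IsStrongDeformationRetractOf (f '' sphere 0 1) (closedBall 0 1 \ f '' ball 0 1) := by
  have hcl : closure unitDisc.carrier = closedBall (0 : ℂ) 1 := by
    rw [carrier_unitDisc, closure_ball (0 : ℂ) one_ne_zero]
  have hc' : ContinuousOn f (closure unitDisc.carrier) := by rw [hcl]; exact hc
  have hi' : InjOn f (closure unitDisc.carrier) := by rw [hcl]; exact hi
  set D₁ : JordanDomain := unitDisc.image f hc' hi' with hD₁
  have hD₁c : D₁.carrier = f '' ball 0 1 := rfl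
  have hD₁cl : closure D₁.carrier = f '' closedBall 0 1 := by
    rw [hD₁, closure_carrier_image, hcl]
  have hD₁fr : frontier D₁.carrier = f '' sphere 0 1 := by
    rw [hD₁, frontier_carrier_image, carrier_unitDisc, frontier_ball (0 : ℂ) one_ne_zero]
  have h12 : closure D₁.carrier ⊆ unitDisc.carrier := by
    rw [hD₁cl, carrier_unitDisc]
    exact hsub.image_subset
  obtain ⟨H, hb1, hb2, hann⟩ := exists_homeomorph_image_annulus h12
  rw [carrier_unitDisc] at hb2 hann
  rw [closure_ball (0 : ℂ) one_ne_zero, hD₁c] at hann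
  have hs1 : H '' sphere 0 1 = f '' sphere 0 1 := by
    have := H.image_frontier (ball 0 1)
    rwa [frontier_ball (0 : ℂ) one_ne_zero, hb1, hD₁fr] at this
  have hs2 : H '' sphere 0 2 = sphere 0 1 := by
    have := H.image_frontier (ball 0 2)
    rwa [frontier_ball (0 : ℂ) two_ne_zero, hb2, frontier_ball (0 : ℂ) one_ne_zero] at this
  have hA1 := (sdr_sphere_annulus (a := 1) (b := 2) (c := 1) one_pos le_rfl
    one_le_two).image_of_isEmbedding H.isEmbedding
  have hA2 := (sdr_sphere_annulus (a := 1) (b := 2) (c := 2) one_pos one_le_two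
    le_rfl).image_of_isEmbedding H.isEmbedding
  rw [hann, hs1] at hA1
  rw [hann, hs2] at hA2
  exact ⟨hA2, hA1⟩

/-! ### Cells read on `ℂ` -/

/-- A cell `Θ : B̄(0,2) ⊂ ℝ² → X` read on `ℂ` through `Complex.orthonormalBasisOneI` and
extended by a constant: a map `T : ℂ → X`, continuous on `‖z‖ ≤ 2`, injective there if `Θ` is
injective, with `Θ({p ‖z‖}) = T({p ‖z‖})` for every norm condition `p` supported in `[0, 2]`. -/
private theorem exists_plane_ext {X : Type*} [TopologicalSpace X]
    (Θ : C(closedBall (0 : EuclideanSpace ℝ (Fin 2)) 2, X)) :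
    ∃ T : ℂ → X, ContinuousOn T (closedBall 0 2) ∧ (Injective Θ → InjOn T (closedBall 0 2)) ∧
      ∀ p : ℝ → Prop, (∀ r, p r → r ≤ 2) →
        Θ '' {z | p ‖(z : EuclideanSpace ℝ (Fin 2))‖} = T '' {z | p ‖z‖} := by
  set κ := Complex.orthonormalBasisOneI.repr with hκ
  have hmem : ∀ z : ℂ, ‖z‖ ≤ 2 → κ z ∈ closedBall (0 : EuclideanSpace ℝ (Fin 2)) 2 :=
    fun z hz => mem_closedBall_zero_iff.2 (by rwa [κ.norm_map])
  refine ⟨fun z => if h : ‖z‖ ≤ 2 then Θ ⟨κ z, hmem z h⟩ else Θ cellPt, ?_, ?_, ?_⟩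
  · rw [continuousOn_iff_continuous_restrict]
    have heq : (closedBall (0 : ℂ) 2).restrict
          (fun z : ℂ => if h : ‖z‖ ≤ 2 then Θ ⟨κ z, hmem z h⟩ else Θ cellPt) =
        fun z : closedBall (0 : ℂ) 2 => Θ ⟨κ z, hmem z (mem_closedBall_zero_iff.1 z.2)⟩ := by
      funext z
      exact dif_pos (mem_closedBall_zero_iff.1 z.2)
    rw [heq]
    exact Θ.continuous.comp ((κ.continuous.comp continuous_subtype_val).subtype_mk _)
  · intro hinj z hz z' hz' hzz'
    have hz2 := mem_closedBall_zero_iff.1 hz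
    have hz2' := mem_closedBall_zero_iff.1 hz'
    have h' : Θ ⟨κ z, hmem z hz2⟩ = Θ ⟨κ z', hmem z' hz2'⟩ := by
      simpa only [dif_pos hz2, dif_pos hz2'] using hzz'
    exact κ.injective (congrArg Subtype.val (hinj h'))
  · intro p hp
    ext x
    constructor
    · rintro ⟨b, hb, rfl⟩
      have hb' : p ‖(b : EuclideanSpace ℝ (Fin 2))‖ := hb
      have hn : ‖κ.symm b‖ = ‖(b : EuclideanSpace ℝ (Fin 2))‖ := κ.symm.norm_map b
      have hb2 : ‖κ.symm b‖ ≤ 2 := by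
        rw [hn]
        exact mem_closedBall_zero_iff.1 b.2
      refine ⟨κ.symm b, ?_, ?_⟩
      · show p ‖κ.symm b‖
        rw [hn]
        exact hb'
      · simp only [dif_pos hb2]
        exact congrArg Θ (Subtype.ext (κ.apply_symm_apply b))
    · rintro ⟨z, hz, rfl⟩
      have hz' : p ‖z‖ := hz
      have hz2 : ‖z‖ ≤ 2 := hp _ hz'
      refine ⟨⟨κ z, hmem z hz2⟩, ?_, ?_⟩
      · show p ‖κ z‖
        rw [κ.norm_map]
        exact hz'
      · simp only [dif_pos hz2]

/-! ### The stub -/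

/-- **The 2D annulus theorem step.** For chart-like cells `Φ`, `Ψ` in `F ⊆ X` (`X` Hausdorff)
with `Φ(B̄(0,1)) ⊆ Ψ(B(0,1))`, the region `R = Ψ(B̄(0,1)) ∖ Φ(B(0,1))` strong deformation
retracts onto the outer circle `Ψ(‖z‖ = 1)`, is path connected, and the inclusion of the inner
circle `Φ(‖z‖ = 1) ↪ R` maps any generator of `π₁(Φ(‖z‖ = 1), Φ(1,0))` to a generator of
`π₁(R, Φ(1,0))` (in `Ψ`'s planar coordinates `R` is the closed region between the unit circle and
the Jordan curve `Ψ⁻¹Φ(‖z‖ = 1)`, a closed annulus by the annulus theorem, Moise (1977) Ch. 4;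
Hatcher, Prop. 1.17). -/
theorem stub_nestedCellsRegion {X : Type} [TopologicalSpace X] [T2Space X] {F : Set X}
    (hF : IsClosed F) (Φ Ψ : C(closedBall (0 : EuclideanSpace ℝ (Fin 2)) 2, X)) (OΦ OΨ : Set X)
    (hΦ : IsChartCell F Φ OΦ) (hΨ : IsChartCell F Ψ OΨ) (hnest : cellDisc Φ ⊆ cellHole Ψ) :
    IsStrongDeformationRetractOf (cellCircle Ψ) (cellDisc Ψ \ cellHole Φ) ∧
    IsPathConnected (cellDisc Ψ \ cellHole Φ) ∧
    ∃ (hx : Φ cellPt ∈ cellCircle Φ) (hCR : cellCircle Φ ⊆ cellDisc Ψ \ cellHole Φ),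
      ∀ t : FundamentalGroup ↥(cellCircle Φ) ⟨Φ cellPt, hx⟩, Subgroup.closure {t} = ⊤ →
        Subgroup.closure {inclHomOfSubset hCR _ hx (hCR hx) t} = ⊤ := by
  -- `F` closed is part of the registered signature but not needed here
  obtain ⟨-⟩ := hF
  -- the two cells read on `ℂ`
  obtain ⟨TΦ, hTΦc, hTΦi, hTΦim⟩ := exists_plane_ext Φ
  obtain ⟨TΨ, hTΨc, hTΨi, hTΨim⟩ := exists_plane_ext Ψ
  have h12 : closedBall (0 : ℂ) 1 ⊆ closedBall 0 2 := closedBall_subset_closedBall one_le_two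
  have hTΦc1 := hTΦc.mono h12
  have hTΨc1 := hTΨc.mono h12
  have hTΦi1 := (hTΦi hΦ.1).mono h12
  have hTΨi1 := (hTΨi hΨ.1).mono h12
  -- the named sets in these coordinates
  have hp1 : ∀ r : ℝ, r ≤ 1 → r ≤ 2 := fun r hr => hr.trans one_le_two
  have eDiscΨ : cellDisc Ψ = TΨ '' closedBall 0 1 := by
    show Ψ '' _ = _
    rw [hTΨim (fun r => r ≤ 1) hp1]
    congr 1
    ext z
    simp
  have eCircΨ : cellCircle Ψ = TΨ '' sphere 0 1 := by
    show Ψ '' _ = _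
    rw [hTΨim (fun r => r = 1) fun r hr => hp1 r hr.le]
    congr 1
    ext z
    simp
  have eHoleΨ : cellHole Ψ = TΨ '' ball 0 1 := by
    show Ψ '' _ = _
    rw [hTΨim (fun r => r < 1) fun r hr => hp1 r hr.le]
    congr 1
    ext z
    simp
  have eDiscΦ : cellDisc Φ = TΦ '' closedBall 0 1 := by
    show Φ '' _ = _
    rw [hTΦim (fun r => r ≤ 1) hp1]
    congr 1
    ext z
    simp
  have eCircΦ : cellCircle Φ = TΦ '' sphere 0 1 := by
    show Φ '' _ = _
    rw [hTΦim (fun r => r = 1) fun r hr => hp1 r hr.le]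
    congr 1
    ext z
    simp
  have eHoleΦ : cellHole Φ = TΦ '' ball 0 1 := by
    show Φ '' _ = _
    rw [hTΦim (fun r => r < 1) fun r hr => hp1 r hr.le]
    congr 1
    ext z
    simp
  -- `Φ(B̄(0,1)) ⊆ Ψ(B(0,1))` in these coordinates
  have hmaps : MapsTo TΦ (closedBall (0 : ℂ) 1) (TΨ '' ball 0 1) := by
    intro z hz
    rw [← eHoleΨ]
    refine hnest ?_
    rw [eDiscΦ]
    exact mem_image_of_mem TΦ hz
  -- the transition map `f = Ψ⁻¹ ∘ Φ` on the closed unit disc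
  obtain ⟨f, hfT, hfb, hfc, hfi⟩ : ∃ f : ℂ → ℂ, (∀ z ∈ closedBall (0 : ℂ) 1, TΨ (f z) = TΦ z) ∧
      MapsTo f (closedBall 0 1) (ball 0 1) ∧ ContinuousOn f (closedBall 0 1) ∧
      InjOn f (closedBall 0 1) := by
    have hex : ∀ z ∈ closedBall (0 : ℂ) 1, ∃ w ∈ closedBall (0 : ℂ) 1, TΨ w = TΦ z :=
      fun z hz => by
        obtain ⟨w, hw, hwz⟩ := hmaps hz
        exact ⟨w, ball_subset_closedBall hw, hwz⟩
    refine ⟨fun z => invFunOn TΨ (closedBall 0 1) (TΦ z), fun z hz => invFunOn_eq (hex z hz),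
      ?_, ?_, ?_⟩
    · intro z hz
      obtain ⟨w, hw, hwz⟩ := hmaps hz
      have hw' : invFunOn TΨ (closedBall 0 1) (TΦ z) = w :=
        hTΨi1 (invFunOn_mem (hex z hz)) (ball_subset_closedBall hw)
          ((invFunOn_eq (hex z hz)).trans hwz.symm)
      show invFunOn TΨ (closedBall 0 1) (TΦ z) ∈ ball 0 1
      rw [hw']
      exact hw
    · exact (continuousOn_invFunOn_of_isCompact (isCompact_closedBall 0 1) hTΨc1
        hTΨi1.bijOn_image).comp hTΦc1 (hmaps.mono_right (image_mono ball_subset_closedBall))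
    · intro z hz z' hz' hzz'
      have h : TΨ (invFunOn TΨ (closedBall 0 1) (TΦ z)) =
          TΨ (invFunOn TΨ (closedBall 0 1) (TΦ z')) := congrArg TΨ hzz'
      rw [invFunOn_eq (hex z hz), invFunOn_eq (hex z' hz')] at h
      exact hTΦi1 hz hz' h
  have hTf : ∀ A ⊆ closedBall (0 : ℂ) 1, TΨ '' (f '' A) = TΦ '' A := fun A hA => by
    rw [image_image]
    exact image_congr fun z hz => hfT z (hA hz)
  have hfbK : f '' ball 0 1 ⊆ closedBall (0 : ℂ) 1 :=
    (image_mono ball_subset_closedBall).trans (hfb.image_subset.trans ball_subset_closedBall)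
  have hfsK : f '' sphere 0 1 ⊆ closedBall (0 : ℂ) 1 :=
    (image_mono sphere_subset_closedBall).trans (hfb.image_subset.trans ball_subset_closedBall)
  have eR : cellDisc Ψ \ cellHole Φ = TΨ '' (closedBall 0 1 \ f '' ball 0 1) := by
    rw [hTΨi1.image_sdiff_subset hfbK, hTf _ ball_subset_closedBall, eDiscΨ, eHoleΦ]
  -- the planar statement, transported along `Ψ`
  obtain ⟨hP1, hP3⟩ := planar hfc hfi hfb
  have h1 : IsStrongDeformationRetractOf (cellCircle Ψ) (cellDisc Ψ \ cellHole Φ) := by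
    rw [eR, eCircΨ]
    exact sdr_image (isCompact_closedBall 0 1) hTΨc1 hTΨi1 sphere_subset_closedBall sdiff_subset hP1
  have h3 : IsStrongDeformationRetractOf (cellCircle Φ) (cellDisc Ψ \ cellHole Φ) := by
    rw [eR, eCircΦ, ← hTf _ sphere_subset_closedBall]
    exact sdr_image (isCompact_closedBall 0 1) hTΨc1 hTΨi1 hfsK sdiff_subset hP3
  -- base point and inclusions
  have hx : Φ cellPt ∈ cellCircle Φ := ⟨cellPt, by simp [cellPt], rfl⟩
  have hCR : cellCircle Φ ⊆ cellDisc Ψ \ cellHole Φ := by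
    rintro x ⟨z, hz, rfl⟩
    have hz1 : ‖(z : EuclideanSpace ℝ (Fin 2))‖ = 1 := hz
    refine ⟨?_, ?_⟩
    · exact (image_mono fun w (hw : ‖(w : EuclideanSpace ℝ (Fin 2))‖ < 1) => hw.le :
        cellHole Ψ ⊆ cellDisc Ψ) (hnest ⟨z, hz1.le, rfl⟩)
    · rintro ⟨w, hw, hwz⟩
      have hw1 : ‖(w : EuclideanSpace ℝ (Fin 2))‖ < 1 := hw
      obtain rfl := hΦ.1 hwz
      exact absurd hz1 hw1.ne
  have hCΨR : cellCircle Ψ ⊆ cellDisc Ψ \ cellHole Φ := by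
    rintro x ⟨z, hz, rfl⟩
    have hz1 : ‖(z : EuclideanSpace ℝ (Fin 2))‖ = 1 := hz
    refine ⟨⟨z, hz1.le, rfl⟩, fun hxΦ => ?_⟩
    obtain ⟨w, hw, hwz⟩ := hnest ((image_mono fun w (hw : ‖(w : EuclideanSpace ℝ (Fin 2))‖ < 1) =>
      hw.le : cellHole Φ ⊆ cellDisc Φ) hxΦ)
    have hw1 : ‖(w : EuclideanSpace ℝ (Fin 2))‖ < 1 := hw
    obtain rfl := hΨ.1 hwz
    exact absurd hz1 hw1.ne
  refine ⟨h1, isPathConnected_of_sdr h1 hCΨR (isPathConnected_image_sphere Ψ), hx, hCR,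
    fun t ht => ?_⟩
  -- generators go to generators: the inclusion is a `π₁`-isomorphism (Hatcher, Prop. 1.17)
  have hbij := bijective_inclHomOfSubset_of_isStrongDeformationRetractOf h3 hCR hx
  have hmap : Subgroup.closure {inclHomOfSubset hCR (Φ cellPt) hx (hCR hx) t} =
      (Subgroup.closure {t}).map (inclHomOfSubset hCR (Φ cellPt) hx (hCR hx)) := by
    rw [MonoidHom.map_closure, image_singleton]
  rw [hmap, ht, ← MonoidHom.range_eq_map, MonoidHom.range_eq_top]
  exact hbij.2

end Summit.SmoothPoincare4.SmoothPoincare4.Cruxes.AgkCor6Sufficiency.LpBySphereSystemSurgery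

end
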